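import Summits.QuantumFields.QCD.Theorems.GaussianLinkFramesFrameFMClosurePlacementSidesAux2
import Literature.Barriers.AtomisticToContinuum.CohnElkiesNotSharp3DKernelSound

/-!
# Crux `GaussianLinkFrames.FrameFMClosure` (stmt-QuantumFields-17375), line `pad-the-fibre`, stub
`stub_placementSides` — helper 3: the balanced canonical placement for the EVEN-BOX side `A = ebox S z r`

For `a, b ∈ A = ebox S z r` (`1 ≤ r`, `r + 1 ≤ S`, `4 ≤ S`) each point gets a pad holding it in its core, aligned in
coordinate `0` with the domino tiling of the box (`{L, L+1}, {L+2, L+3}, …`, `L = z₀ - r - 1`): a site at an even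
box-offset `i ≥ 2` takes the pad `[i-2, i+1]`, an odd offset `i ≤ 2r-1` the pad `[i-1, i+2]`, and the two extreme
offsets `i = 0`, `i = 2r+1` a pad whose far layer (outside the box, possibly wrapping around the torus) is FROZEN, so
that the refitted block meets the box in `{L, L+1}` resp. `{U-1, U}` (`box_coord_data`).  The global flip of
coordinate `0` along the box tiling then pairs each clipped block `P ∩ A` inside itself (`box_block`), and helper 5's
`balanced_touched_of_blocks` gives the balance of the touched region (`box_balanced`).

References: elementary [folklore]; the pad recipe is the line card of `pad-the-fibre`.
-/

noncomputable section

open scoped BigOperators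
open Literature.MathematicalPhysics.QuantumFieldTheory Literature.MathematicalPhysics.QuantumLattice
  Literature.Probability.LatticeModels
open Summit.QuantumFields.QCD.Theorems.VonMisesCircles Summit.QuantumFields.QCD.Theorems.PadTheFibre

namespace Summit.QuantumFields.QCD.Theorems.PadTheFibreTwoStar

/-! ## §1 One more offset lemma (the `val` of a difference is `CEKernel.val_sub_eq` of the tree) -/

/-- Transfer of offsets between two base residues `L` and `B` at offset `d`. [folklore] -/
theorem val_sub_transfer {N : ℕ} [NeZero N] (L B : ZMod N) (d : ℕ) (hd : (B - L).val = d) (u : ZMod N) :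
    (u - B).val = if d ≤ (u - L).val then (u - L).val - d else (u - L).val + N - d := by
  rw [show u - B = (u - L) - (B - L) by ring, Literature.Barriers.AtomisticToContinuum.CEKernel.val_sub_eq, hd]

/-! ## §2 Coordinate `0` of a box placement: the aligned pad -/

/-- **Aligned pad data in the tiling coordinate.**  For a residue `c₀` at box-offset `i = (c₀ - L).val ≤ 2r+1`
there are a pad base `B` (the pad occupies offsets `[0,3]` from `B`), frozen data `(M, cf)` (`M ⊆ {0}`: nothing, the
bottom layer at pad-offset `0`, or the top layer at pad-offset `3`) and a window `[k₁, k₂]` of box-offsets with `k₁`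
even, `k₂` odd, `k₂ ≤ 2r+1`, such that `c₀` sits in the core (pad-offset `1` or `2`) away from the frozen layer, and a
residue INSIDE the box lies in the refitted block (pad-offset `≤ 3`, not frozen) iff its box-offset lies in the
window. [folklore] -/
theorem box_coord_data {N : ℕ} [NeZero N] (r : ℕ) (hr : 1 ≤ r) (hN : 2 * r + 3 ≤ N) (L c₀ : ZMod N)
    (hc₀ : (c₀ - L).val ≤ 2 * r + 1) :
    ∃ (B : ZMod N) (M : Finset (Fin 4)) (cf : Fin 4 → ℤ) (k₁ k₂ : ℕ), (∀ μ ∈ M, cf μ = -2 ∨ cf μ = 1) ∧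
      (∀ μ ∈ M, μ = 0) ∧ ((c₀ - B).val = 1 ∨ (c₀ - B).val = 2) ∧
      (∀ μ ∈ M, (cf μ = -2 → (c₀ - B).val = 2) ∧ (cf μ = 1 → (c₀ - B).val = 1)) ∧
      Even k₁ ∧ Odd k₂ ∧ k₂ ≤ 2 * r + 1 ∧
      ∀ u : ZMod N,
        (((u - B).val ≤ 3 ∧ ∀ μ ∈ M, ((u - B).val : ℤ) ≠ cf μ + 2) ∧ (u - L).val ≤ 2 * r + 1 →
            k₁ ≤ (u - L).val ∧ (u - L).val ≤ k₂) ∧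
        (k₁ ≤ (u - L).val ∧ (u - L).val ≤ k₂ → (u - B).val ≤ 3 ∧ ∀ μ ∈ M, ((u - B).val : ℤ) ≠ cf μ + 2) := by
  set i := (c₀ - L).val with hi
  have h2N : ((2 : ℕ) : ZMod N) ≠ 0 := by
    intro h; rw [ZMod.natCast_eq_zero_iff] at h; have := Nat.le_of_dvd (by norm_num) h; omega
  rcases Nat.even_or_odd i with he | ho
  · by_cases h2 : 2 ≤ i
    · -- case A: even offset `≥ 2`, pad `[i-2, i+1]`, nothing frozen
      refine ⟨c₀ - 2, ∅, fun _ => 0, i - 2, i + 1, by simp, by simp, Or.inr ?_, by simp, ?_, ?_, ?_, fun u => ?_⟩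
      · rw [show c₀ - (c₀ - 2) = ((2 : ℕ) : ZMod N) by push_cast; ring, ZMod.val_cast_of_lt (by omega)]
      · obtain ⟨m, hm⟩ := he; exact ⟨m - 1, by omega⟩
      · obtain ⟨m, hm⟩ := he; exact ⟨m, by omega⟩
      · obtain ⟨m, hm⟩ := he; omega
      · have hd : (c₀ - 2 - L).val = i - 2 := by
          rw [show c₀ - 2 - L = (c₀ - L) - ((2 : ℕ) : ZMod N) by push_cast; ring]
          exact val_sub_natCast_of_le _ 2 h2
        have ht := val_sub_transfer L (c₀ - 2) (i - 2) hd u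
        have hul : (u - L).val < N := ZMod.val_lt _
        simp only [Finset.notMem_empty, false_implies, implies_true, and_true]
        constructor
        · rintro ⟨hs, htl⟩
          rw [ht] at hs
          split_ifs at hs with h <;> omega
        · rintro ⟨h1, h3⟩
          rw [ht, if_pos h1]; omega
    · -- case B: offset `0`, pad `[-2, 1]` with the bottom layer frozen, block `∩` box `= {L, L+1}`
      have hi0 : i = 0 := by obtain ⟨m, hm⟩ := he; omega
      have hcL : c₀ = L := by
        have : c₀ - L = 0 := (ZMod.val_eq_zero _).1 (by rw [← hi]; exact hi0)
        exact sub_eq_zero.1 this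
      have hcB : (c₀ - (c₀ - 2)).val = 2 := by
        rw [show c₀ - (c₀ - 2) = ((2 : ℕ) : ZMod N) by push_cast; ring, ZMod.val_cast_of_lt (by omega)]
      refine ⟨c₀ - 2, {0}, fun _ => -2, 0, 1, by simp, by simp, Or.inr hcB, ?_, ⟨0, rfl⟩, ⟨0, rfl⟩, by omega,
        fun u => ?_⟩
      · intro μ _; exact ⟨fun _ => hcB, fun h => by norm_num at h⟩
      · have hd : (c₀ - 2 - L).val = N - 2 := by
          rw [hcL, show L - 2 - L = -((2 : ℕ) : ZMod N) by push_cast; ring, ZMod.neg_val, if_neg h2N,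
            ZMod.val_cast_of_lt (by omega)]
        have ht := val_sub_transfer L (c₀ - 2) (N - 2) hd u
        have hul : (u - L).val < N := ZMod.val_lt _
        simp only [Finset.mem_singleton, forall_eq]
        constructor
        · rintro ⟨⟨hs, hs0⟩, htl⟩
          rw [ht] at hs hs0
          split_ifs at hs hs0 with h <;> omega
        · rintro ⟨-, h3⟩
          rw [ht, if_neg (by omega)]
          constructor <;> omega
  · by_cases h2 : i ≤ 2 * r - 1
    · -- case C: odd offset `≤ 2r-1`, pad `[i-1, i+2]`, nothing frozen
      refine ⟨c₀ - 1, ∅, fun _ => 0, i - 1, i + 2, by simp, by simp, Or.inl ?_, by simp, ?_, ?_, ?_, fun u => ?_⟩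
      · rw [show c₀ - (c₀ - 1) = ((1 : ℕ) : ZMod N) by push_cast; ring, ZMod.val_cast_of_lt (by omega)]
      · obtain ⟨m, hm⟩ := ho; exact ⟨m, by omega⟩
      · obtain ⟨m, hm⟩ := ho; exact ⟨m + 1, by omega⟩
      · omega
      · have h1 : 1 ≤ i := by obtain ⟨m, hm⟩ := ho; omega
        have hd : (c₀ - 1 - L).val = i - 1 := by
          rw [show c₀ - 1 - L = (c₀ - L) - ((1 : ℕ) : ZMod N) by push_cast; ring]
          exact val_sub_natCast_of_le _ 1 h1
        have ht := val_sub_transfer L (c₀ - 1) (i - 1) hd u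
        have hul : (u - L).val < N := ZMod.val_lt _
        simp only [Finset.notMem_empty, false_implies, implies_true, and_true]
        constructor
        · rintro ⟨hs, htl⟩
          rw [ht] at hs
          split_ifs at hs with h <;> omega
        · rintro ⟨h1, h3⟩
          rw [ht, if_pos h1]; omega
    · -- case D: offset `2r+1`, pad `[2r, 2r+3]` with the top layer frozen, block `∩` box `= {U-1, U}`
      have hi1 : i = 2 * r + 1 := by obtain ⟨m, hm⟩ := ho; omega
      have hcB : (c₀ - (c₀ - 1)).val = 1 := by
        rw [show c₀ - (c₀ - 1) = ((1 : ℕ) : ZMod N) by push_cast; ring, ZMod.val_cast_of_lt (by omega)]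
      refine ⟨c₀ - 1, {0}, fun _ => 1, 2 * r, 2 * r + 1, by simp, by simp, Or.inl hcB, ?_, ⟨r, by ring⟩,
        ⟨r, by ring⟩, le_rfl, fun u => ?_⟩
      · intro μ _; exact ⟨fun h => by norm_num at h, fun _ => hcB⟩
      · have hd : (c₀ - 1 - L).val = 2 * r := by
          rw [show c₀ - 1 - L = (c₀ - L) - ((1 : ℕ) : ZMod N) by push_cast; ring,
            val_sub_natCast_of_le _ 1 (by omega)]
          omega
        have ht := val_sub_transfer L (c₀ - 1) (2 * r) hd u
        have hul : (u - L).val < N := ZMod.val_lt _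
        simp only [Finset.mem_singleton, forall_eq]
        constructor
        · rintro ⟨⟨hs, hs3⟩, htl⟩
          rw [ht] at hs hs3
          split_ifs at hs hs3 with h <;> omega
        · rintro ⟨h1, h3⟩
          rw [ht, if_pos h1]
          constructor <;> omega

/-! ## §3 The aligned block of one point and its stability under the box flip -/

/-- **The aligned block of a box point.**  For `c ∈ ebox S z r` (`1 ≤ r`, `r+1 ≤ S`, `2 ≤ S`) there are a pad centre
`x'` holding `c` in its core and frozen data `(M, cf)` (at most the far layer in coordinate `0`) such that the star
of `c` lies in the interior `P = pad ∖ frozen`, and the flip of coordinate `0` along the domino tiling of the box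
(`u ↦ u ± 1` by the parity of the box-offset `(u - L).val`, `L = z₀ - (r+1)`) maps `P ∩ A` into itself, is an
involution there and moves by `± e₀`. [folklore] -/
theorem box_block {S : ℕ} (hS : 2 ≤ S) (z : TorusSite 4 (2 * S + 1)) (r : ℕ) (hr₁ : 1 ≤ r) (hr₂ : r + 1 ≤ S)
    (c : TorusSite 4 (2 * S + 1)) (hc : c ∈ ebox S z r) :
    ∃ (x' : TorusSite 4 (2 * S + 1)) (M : Finset (Fin 4)) (cf : Fin 4 → ℤ), (∀ μ ∈ M, cf μ = -2 ∨ cf μ = 1) ∧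
      c ∈ ebox S x' 0 ∧
      (c ∈ ebox S x' 1 \ padFrozen S x' M cf ∧ ∀ μ : Fin 4, c + Pi.single μ 1 ∈ ebox S x' 1 \ padFrozen S x' M cf ∧
        c - Pi.single μ 1 ∈ ebox S x' 1 \ padFrozen S x' M cf) ∧
      let σ : TorusSite 4 (2 * S + 1) → TorusSite 4 (2 * S + 1) := fun y => Function.update y 0
        (if Even (y 0 - (z 0 - ((r + 1 : ℕ) : ZMod (2 * S + 1)))).val then y 0 + 1 else y 0 - 1)
      ∀ y ∈ ebox S x' 1 \ padFrozen S x' M cf, y ∈ ebox S z r →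
        σ y ∈ ebox S x' 1 \ padFrozen S x' M cf ∧ σ y ∈ ebox S z r ∧ σ (σ y) = y ∧
          (σ y = y + Pi.single 0 1 ∨ y = σ y + Pi.single 0 1) := by
  haveI : NeZero (2 * S + 1) := ⟨by omega⟩
  set L : ZMod (2 * S + 1) := z 0 - ((r + 1 : ℕ) : ZMod (2 * S + 1)) with hL
  have hA : ∀ y : TorusSite 4 (2 * S + 1), y ∈ ebox S z r ↔
      ∀ i, (y i - (z i - ((r + 1 : ℕ) : ZMod (2 * S + 1)))).val ≤ 2 * r + 1 := by
    intro y
    rw [mem_ebox_iff_val z y r hr₂]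
    have : ∀ i, y i - z i + ((r + 1 : ℕ) : ZMod (2 * S + 1)) = y i - (z i - ((r + 1 : ℕ) : ZMod (2 * S + 1))) :=
      fun i => by ring
    simp only [this]
  have hc₀ : (c 0 - L).val ≤ 2 * r + 1 := (hA c).1 hc 0
  obtain ⟨B, M, cf, k₁, k₂, hcfM, hM0, hcore, hfar, hk₁, hk₂, hk₂r, hwin⟩ :=
    box_coord_data r hr₁ (by omega) L (c 0) hc₀
  -- the pad centre
  set x' : TorusSite 4 (2 * S + 1) := Function.update c 0 (B + 2) with hx'
  have hx'0 : x' 0 = B + 2 := by rw [hx', Function.update_self]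
  have hx'i : ∀ i, i ≠ 0 → x' i = c i := fun i hi => by rw [hx', Function.update_of_ne hi]
  -- the interior read in coordinates
  have hoff0 : ∀ y : TorusSite 4 (2 * S + 1), y 0 - x' 0 + 2 = y 0 - B := fun y => by rw [hx'0]; ring
  have hP : ∀ y : TorusSite 4 (2 * S + 1), y ∈ ebox S x' 1 \ padFrozen S x' M cf ↔
      (∀ i, i ≠ 0 → (y i - c i + 2).val ≤ 3) ∧
        ((y 0 - B).val ≤ 3 ∧ ∀ μ ∈ M, ((y 0 - B).val : ℤ) ≠ cf μ + 2) := by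
    intro y
    rw [mem_interior_iff_val hS x' y M cf]
    constructor
    · rintro ⟨h1, h2⟩
      refine ⟨fun i hi => by rw [← hx'i i hi]; exact h1 i, by rw [← hoff0]; exact h1 0, fun μ hμ => ?_⟩
      have := h2 μ hμ
      have e := hM0 μ hμ; subst e
      rw [hoff0] at this
      exact this
    · rintro ⟨h1, h2, h3⟩
      refine ⟨fun i => ?_, fun μ hμ => ?_⟩
      · by_cases hi : i = 0
        · subst hi; rw [hoff0]; exact h2
        · rw [hx'i i hi]; exact h1 i hi
      · have := h3 μ hμ
        have e := hM0 μ hμ; subst e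
        rw [hoff0]
        exact this
  refine ⟨x', M, cf, hcfM, ?_, ?_, ?_⟩
  · -- core
    rw [mem_core_iff_val (by omega) x' c]
    intro i
    by_cases hi : i = 0
    · subst hi
      have h1 : 1 ≤ (c 0 - B).val := by rcases hcore with h | h <;> omega
      rw [show c 0 - x' 0 + 1 = (c 0 - B) - 1 by rw [hx'0]; ring, val_sub_one_of_le _ h1]
      rcases hcore with h | h <;> omega
    · rw [hx'i i hi, show c i - c i + 1 = ((1 : ℕ) : ZMod (2 * S + 1)) by push_cast; ring,
        ZMod.val_cast_of_lt (by omega)]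
  · -- star inside the interior
    refine star_subset_interior hS x' c M cf hcfM (fun i => ?_) (fun μ hμ => ?_)
    · by_cases hi : i = 0
      · subst hi; rw [hoff0]; exact hcore
      · rw [hx'i i hi, show c i - c i + 2 = ((2 : ℕ) : ZMod (2 * S + 1)) by push_cast; ring,
          ZMod.val_cast_of_lt (by omega)]; right; trivial
    · have e := hM0 μ hμ; subst e
      rw [hoff0]
      exact hfar 0 hμ
  · -- stability of `P ∩ A` under the flip
    intro σ y hy hyA
    rw [hP] at hy
    obtain ⟨hyi, hy0⟩ := hy
    have hyA' := (hA y).1 hyA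
    have ht0 : (y 0 - L).val ≤ 2 * r + 1 := hyA' 0
    obtain ⟨hw1, hw2⟩ := (hwin (y 0)).1 ⟨hy0, ht0⟩
    have hkN : k₂ + 2 ≤ 2 * S + 1 := by omega
    have F := flip_window L k₁ k₂ hk₁ hk₂ hkN (y 0) hw1 hw2
    simp only at F
    obtain ⟨hF1, hF2, hFinv, hFnn, -⟩ := F
    have hσy : σ y = Function.update y 0 (if Even (y 0 - L).val then y 0 + 1 else y 0 - 1) := rfl
    have hσ0 : σ y 0 = (if Even (y 0 - L).val then y 0 + 1 else y 0 - 1) := by rw [hσy, Function.update_self]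
    have hσi : ∀ i, i ≠ 0 → σ y i = y i := fun i hi => by rw [hσy, Function.update_of_ne hi]
    refine ⟨?_, ?_, ?_, ?_⟩
    · rw [hP]
      refine ⟨fun i hi => by rw [hσi i hi]; exact hyi i hi, ?_⟩
      rw [hσ0]
      exact (hwin _).2 ⟨hF1, hF2⟩
    · rw [hA]
      intro i
      by_cases hi : i = 0
      · subst hi; rw [hσ0]; exact hF2.trans hk₂r
      · rw [hσi i hi]; exact hyA' i
    · show Function.update (σ y) 0 _ = y
      rw [hσ0, hFinv, hσy]
      simp
    · rcases hFnn with h | h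
      · left; rw [hσy, h]; ext i
        by_cases hi : i = 0
        · subst hi; simp
        · simp [hi]
      · right; rw [hσy]; ext i
        by_cases hi : i = 0
        · subst hi; simp; exact h
        · simp [hi]

/-! ## §4 The balanced placement for the box side -/

open Classical in
/-- **Balanced canonical placement for the even-box side** (`2 ≤ S`, `1 ≤ r`, `r + 1 ≤ S`): for `a, b ∈ ebox S z r`
there are pads holding `a`, `b` in their cores and canonical pad regions `Q₁, Q₂` about them (forced links of the
aligned blocks, `⊆ padLinks`) such that the touched region of `star(a) ∪ star(b) ∪ Q₁ ∪ Q₂` inside the box is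
bipartite-balanced. [folklore] -/
theorem box_balanced {S : ℕ} (hS : 2 ≤ S) (z : TorusSite 4 (2 * S + 1)) (r : ℕ) (hr₁ : 1 ≤ r) (hr₂ : r + 1 ≤ S)
    (a b : TorusSite 4 (2 * S + 1)) (ha : a ∈ ebox S z r) (hb : b ∈ ebox S z r) :
    ∃ (x' y' : TorusSite 4 (2 * S + 1)) (Q₁ Q₂ : Finset (Edge 4 (2 * S + 1))),
      a ∈ ebox S x' 0 ∧ b ∈ ebox S y' 0 ∧ IsPadRegion S x' Q₁ ∧ IsPadRegion S y' Q₂ ∧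
      Q₁ ⊆ padLinks S x' ∧ Q₂ ⊆ padLinks S y' ∧
      Balanced (touched S (ebox S z r) (starLinks S a ∪ starLinks S b ∪ Q₁ ∪ Q₂)) := by
  obtain ⟨x', M₁, c₁, hc₁, hax, hast, hσ₁⟩ := box_block hS z r hr₁ hr₂ a ha
  obtain ⟨y', M₂, c₂, hc₂, hby, hbst, hσ₂⟩ := box_block hS z r hr₁ hr₂ b hb
  simp only at hσ₁ hσ₂
  set σ : TorusSite 4 (2 * S + 1) → TorusSite 4 (2 * S + 1) := fun y => Function.update y 0
    (if Even (y 0 - (z 0 - ((r + 1 : ℕ) : ZMod (2 * S + 1)))).val then y 0 + 1 else y 0 - 1) with hσ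
  set P₁ := ebox S x' 1 \ padFrozen S x' M₁ c₁ with hP₁
  set P₂ := ebox S y' 1 \ padFrozen S y' M₂ c₂ with hP₂
  set Q₁ := (padLinks S x').filter fun e : Edge 4 (2 * S + 1) =>
    e.1 ∉ padFrozen S x' M₁ c₁ ∧ e.1.shift e.2 ∉ padFrozen S x' M₁ c₁ with hQ₁
  set Q₂ := (padLinks S y').filter fun e : Edge 4 (2 * S + 1) =>
    e.1 ∉ padFrozen S y' M₂ c₂ ∧ e.1.shift e.2 ∉ padFrozen S y' M₂ c₂ with hQ₂
  have hreg₁ : IsPadRegion S x' Q₁ := by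
    have := isPadRegion_forced_union x' M₁ c₁ hc₁ ∅ (Finset.empty_subset _)
    rwa [Finset.union_empty] at this
  have hreg₂ : IsPadRegion S y' Q₂ := by
    have := isPadRegion_forced_union y' M₂ c₂ hc₂ ∅ (Finset.empty_subset _)
    rwa [Finset.union_empty] at this
  refine ⟨x', y', Q₁, Q₂, hax, hby, hreg₁, hreg₂, Finset.filter_subset _ _, Finset.filter_subset _ _, ?_⟩
  have hsa := star_subset_forced x' a M₁ c₁ hast
  have hsb := star_subset_forced y' b M₂ c₂ hbst
  intro χ hχ
  refine balanced_touched_of_blocks (ebox S z r) (starLinks S a ∪ starLinks S b ∪ Q₁ ∪ Q₂) P₁ P₂ σ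
    ?_ ?_ ?_ ?_ ?_ ?_ ?_ χ hχ
  · intro e he
    simp only [Finset.mem_union] at he
    rcases he with ((h | h) | h) | h
    · exact Or.inl (hsa e h)
    · exact Or.inr (hsb e h)
    · exact Or.inl ((mem_forced_iff x' M₁ c₁ e).1 h)
    · exact Or.inr ((mem_forced_iff y' M₂ c₂ e).1 h)
  · intro w μ hw hw'
    simp only [Finset.mem_union]
    exact Or.inl (Or.inr ((mem_forced_iff x' M₁ c₁ (w, μ)).2 ⟨hw, hw'⟩))
  · intro w μ hw hw'
    simp only [Finset.mem_union]
    exact Or.inr ((mem_forced_iff y' M₂ c₂ (w, μ)).2 ⟨hw, hw'⟩)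
  · intro w hw hwA
    exact ⟨(hσ₁ w hw hwA).1, (hσ₁ w hw hwA).2.1⟩
  · intro w hw hwA
    exact ⟨(hσ₂ w hw hwA).1, (hσ₂ w hw hwA).2.1⟩
  · intro w hw hwA
    rcases Finset.mem_union.1 hw with h | h
    · exact (hσ₁ w h hwA).2.2.1
    · exact (hσ₂ w h hwA).2.2.1
  · intro w hw hwA
    rcases Finset.mem_union.1 hw with h | h
    · exact ⟨0, (hσ₁ w h hwA).2.2.2⟩
    · exact ⟨0, (hσ₂ w h hwA).2.2.2⟩

/-- **Registered helper `stub_placementSides_aux3` of crux stmt-QuantumFields-17375** (line `pad-the-fibre`, stub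
`stub_placementSides`): the balanced canonical placement for the even-box side. [folklore] -/
theorem stub_placementSides_aux3 : ∀ (S : ℕ), 2 ≤ S → ∀ (z : TorusSite 4 (2 * S + 1)) (r : ℕ), 1 ≤ r → r + 1 ≤ S → ∀ (a b : TorusSite 4 (2 * S + 1)), a ∈ ebox S z r → b ∈ ebox S z r → ∃ (x' y' : TorusSite 4 (2 * S + 1)) (Q₁ Q₂ : Finset (Edge 4 (2 * S + 1))), a ∈ ebox S x' 0 ∧ b ∈ ebox S y' 0 ∧ IsPadRegion S x' Q₁ ∧ IsPadRegion S y' Q₂ ∧ Q₁ ⊆ padLinks S x' ∧ Q₂ ⊆ padLinks S y' ∧ Balanced (touched S (ebox S z r) (starLinks S a ∪ starLinks S b ∪ Q₁ ∪ Q₂)) :=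
  fun _ hS z r hr₁ hr₂ a b ha hb => box_balanced hS z r hr₁ hr₂ a b ha hb

end Summit.QuantumFields.QCD.Theorems.PadTheFibreTwoStar

end
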